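import Summits.Ventures.YMGap.FlowData.SU2WeightCharacterSeries
import Summits.Ventures.YMGap.FlowData.TubeTransferOperator
import HarnessLib

/-!
# Venture YMGap, track Y3 FLOW-DATA — product characters on a time slice of SU(2) links: bounds, the
# multi-link merging rule, and the reproducing ("isotypic") integrals (theorems only; file 1/2)

HONEST FRAMING: venture file of the cell `pub-ymgap` (QuantumFields programme), track Y3; companion THEOREMS for
`FlowData/TubeTransferOperator.lean` preparing the STRONG-COUPLING WINDOW for the typed torelon energy
(`FlowData/TubeStrongCouplingWindow.lean`: `|E₁(β) − L·(−ln u(β))| ≤ 2β·#plaquettes` on every finite tube).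
Finite Haar integrals over `SU(2)^{links}`; no number, no row, nothing about limits or a mass gap.  NO Peter–Weyl:
only the Haar face-merging rule of the prior venture (`integral_su2Character_mul_conv`:
`∫ χ_m(AV) χ_n(V⁻¹B) dV = [m = n] χ_n(AB)/(n+1)`) is used, link by link.

For a multi-index `ν : links → ℕ` on the spatial torus `(ℤ/L)^k` write (in the docstrings only)
`X_ν(a, b) = ∏_e χ_{ν_e}(b_e a_e⁻¹)` (`χ_n = U_n(a₀)` the `SU(2)` characters), `d_ν = ∏_e (ν_e + 1)` and
`(p_ν h)(a) = d_ν ∫ X_ν(a, b) h(b) db` (slice Haar measure `db`).  This file proves, with everything spelled out: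

* `abs_prod_su2Character_le`, `prod_su2Character_swap` — `|X_ν| ≤ d_ν`, `X_ν(a, b) = X_ν(b, a)`;
* **`integral_prod_su2Character_mul_prod`** — the multi-link merging rule
  `∫ X_ν(a, V) X_{ν'}(V, c) dV = [ν = ν'] X_ν(a, c)/d_ν`;
* `continuous_charProj`, `abs_charProj_le` — `p_ν h` is continuous and bounded by `d_ν² ∫|h|` for integrable `h`;
* `memLp_two_of_continuous`, `abs_integral_mul_le_sqrt_mul_sqrt` — book-keeping (continuous functions on the compact
  slice are square integrable; Cauchy–Schwarz for real square-integrable functions).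

File 2/2 (`FlowData/SliceCharacterBessel.lean`): symmetry, the reproducing property and Bessel's inequality for the `p_ν`.

References: I. Montvay, G. Münster, *Quantum Fields on a Lattice* (1994) §3.2.6, §3.4.2 [cite: MontvayMunster1994, §3.4.2];
J.-M. Drouffe, J.-B. Zuber, Phys. Rept. 102 (1983) 1, §3 (character expansion) [cite: DrouffeZuber1983, §3].
-/

noncomputable section

open scoped BigOperators Topology
open MeasureTheory Filter Function Set Polynomial.Chebyshev
open Literature.MathematicalPhysics.QuantumFieldTheory Literature.MathematicalPhysics.QuantumLattice Literature.Analysis.FunctionSpaces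
open Literature.Analysis.OperatorTheory
open Summit.Ventures.LatticeQCDFlow.Exactness Summit.Ventures.LatticeQCDFlow.Scoring

namespace Summit.Ventures.YMGap.FlowData

/-! ### Product characters: bounds, continuity, symmetry, merging -/

section MultiCharacter

variable {k L : ℕ} [NeZero L]

/-- `|∏_e χ_{ν_e}(g_e)| ≤ ∏_e (ν_e + 1)`. [folklore] -/
theorem abs_prod_su2Character_le (ν : Edge k L → ℕ) (g : Edge k L → Matrix.specialUnitaryGroup (Fin 2) ℂ) :
    |∏ e, (U ℝ (ν e)).eval (su2a0 (g e))| ≤ ∏ e, ((ν e : ℝ) + 1) := by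
  rw [Finset.abs_prod]
  exact Finset.prod_le_prod (fun e _ => abs_nonneg _) fun e _ => abs_su2Character_le (ν e) (g e)

/-- `0 < d_ν = ∏_e (ν_e + 1)`. [folklore] -/
theorem prod_succ_pos (ν : Edge k L → ℕ) : 0 < ∏ e, ((ν e : ℝ) + 1) :=
  Finset.prod_pos fun e _ => by positivity

/-- The product character is a continuous function of the link variables. [folklore] -/
theorem continuous_prod_su2Character (ν : Edge k L → ℕ) :
    Continuous fun g : Edge k L → Matrix.specialUnitaryGroup (Fin 2) ℂ => ∏ e, (U ℝ (ν e)).eval (su2a0 (g e)) :=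
  continuous_finsetProd _ fun e _ => (continuous_su2Character (ν e)).comp (continuous_apply e)

/-- Joint continuity of `(a, b) ↦ X_ν(a, b) = ∏_e χ_{ν_e}(b_e a_e⁻¹)`. [folklore] -/
theorem continuous_prod_su2Character_pair (ν : Edge k L → ℕ) :
    Continuous fun p : GaugeConfig k L (Matrix.specialUnitaryGroup (Fin 2) ℂ) ×
        GaugeConfig k L (Matrix.specialUnitaryGroup (Fin 2) ℂ) =>
      ∏ e, (U ℝ (ν e)).eval (su2a0 (p.2 e * (p.1 e)⁻¹)) :=
  (continuous_prod_su2Character ν).comp (continuous_pi fun e =>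
    ((continuous_apply e).comp continuous_snd).mul ((continuous_apply e).comp continuous_fst).inv)

/-- Continuity of `b ↦ X_ν(a, b)`. [folklore] -/
theorem continuous_prod_su2Character_right (ν : Edge k L → ℕ)
    (a : GaugeConfig k L (Matrix.specialUnitaryGroup (Fin 2) ℂ)) :
    Continuous fun b : GaugeConfig k L (Matrix.specialUnitaryGroup (Fin 2) ℂ) =>
      ∏ e, (U ℝ (ν e)).eval (su2a0 (b e * (a e)⁻¹)) :=
  continuous_finsetProd _ fun e _ =>
    (continuous_su2Character (ν e)).comp ((continuous_apply e).mul continuous_const)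

/-- Continuity of `a ↦ X_ν(a, b)`. [folklore] -/
theorem continuous_prod_su2Character_left (ν : Edge k L → ℕ)
    (b : GaugeConfig k L (Matrix.specialUnitaryGroup (Fin 2) ℂ)) :
    Continuous fun a : GaugeConfig k L (Matrix.specialUnitaryGroup (Fin 2) ℂ) =>
      ∏ e, (U ℝ (ν e)).eval (su2a0 (b e * (a e)⁻¹)) :=
  continuous_finsetProd _ fun e _ =>
    (continuous_su2Character (ν e)).comp (continuous_const.mul (continuous_apply e).inv)

/-- **Symmetry** `X_ν(a, b) = X_ν(b, a)` (the characters of `SU(2)` are real and inversion invariant).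
[folklore] -/
theorem prod_su2Character_swap (ν : Edge k L → ℕ)
    (a b : GaugeConfig k L (Matrix.specialUnitaryGroup (Fin 2) ℂ)) :
    ∏ e, (U ℝ (ν e)).eval (su2a0 (b e * (a e)⁻¹)) = ∏ e, (U ℝ (ν e)).eval (su2a0 (a e * (b e)⁻¹)) := by
  refine Finset.prod_congr rfl fun e _ => ?_
  rw [← su2a0_inv (b e * (a e)⁻¹), mul_inv_rev, inv_inv]

/-- **THE MULTI-LINK MERGING RULE**: `∫ X_ν(a, V) X_{ν'}(V, c) dV = [ν = ν'] X_ν(a, c)/d_ν` for the slice Haar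
measure (`integral_su2Character_mul_conv` link by link and Fubini over the links). [cite: MontvayMunster1994, §3.4.2] -/
theorem integral_prod_su2Character_mul_prod (ν ν' : Edge k L → ℕ)
    (a c : GaugeConfig k L (Matrix.specialUnitaryGroup (Fin 2) ℂ)) :
    ∫ V, (∏ e, (U ℝ (ν e)).eval (su2a0 (V e * (a e)⁻¹))) * (∏ e, (U ℝ (ν' e)).eval (su2a0 (c e * (V e)⁻¹)))
        ∂(sliceMeasure (Matrix.specialUnitaryGroup (Fin 2) ℂ) k L) =
      if ν = ν' then (∏ e, (U ℝ (ν e)).eval (su2a0 (c e * (a e)⁻¹))) / ∏ e, ((ν e : ℝ) + 1) else 0 := by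
  have h1 : ∀ V : GaugeConfig k L (Matrix.specialUnitaryGroup (Fin 2) ℂ),
      (∏ e, (U ℝ (ν e)).eval (su2a0 (V e * (a e)⁻¹))) * (∏ e, (U ℝ (ν' e)).eval (su2a0 (c e * (V e)⁻¹))) =
        ∏ e, (fun (e : Edge k L) (W : Matrix.specialUnitaryGroup (Fin 2) ℂ) =>
          (U ℝ (ν e)).eval (su2a0 (W * (a e)⁻¹)) * (U ℝ (ν' e)).eval (su2a0 (c e * W⁻¹))) e (V e) := fun V => by
    rw [← Finset.prod_mul_distrib]
  simp_rw [h1]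
  rw [integral_fintype_prod_eq_prod
    (μ := fun _ : Edge k L => haarProbability (Matrix.specialUnitaryGroup (Fin 2) ℂ))
    (fun (e : Edge k L) (W : Matrix.specialUnitaryGroup (Fin 2) ℂ) =>
      (U ℝ (ν e)).eval (su2a0 (W * (a e)⁻¹)) * (U ℝ (ν' e)).eval (su2a0 (c e * W⁻¹)))]
  have h2 : ∀ e : Edge k L, ∫ W, (U ℝ (ν e)).eval (su2a0 (W * (a e)⁻¹)) * (U ℝ (ν' e)).eval (su2a0 (c e * W⁻¹))
      ∂haarProbability (Matrix.specialUnitaryGroup (Fin 2) ℂ) =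
      if ν e = ν' e then (U ℝ (ν e)).eval (su2a0 (c e * (a e)⁻¹)) / ((ν e : ℝ) + 1) else 0 := by
    intro e
    have h := integral_su2Character_mul_conv (a e)⁻¹ (c e) (ν e) (ν' e)
    have h' : ∫ W, (U ℝ (ν e)).eval (su2a0 (W * (a e)⁻¹)) * (U ℝ (ν' e)).eval (su2a0 (c e * W⁻¹))
        ∂haarProbability (Matrix.specialUnitaryGroup (Fin 2) ℂ) =
        ∫ W, (U ℝ (ν e)).eval (su2a0 ((a e)⁻¹ * W)) * (U ℝ (ν' e)).eval (su2a0 (W⁻¹ * c e))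
          ∂haarProbability (Matrix.specialUnitaryGroup (Fin 2) ℂ) :=
      integral_congr_ae (Eventually.of_forall fun W => by
        simp only [su2a0_mul_comm W (a e)⁻¹, su2a0_mul_comm (c e) W⁻¹])
    rw [h', h]
    by_cases hne : ν e = ν' e
    · rw [if_pos hne, if_pos hne, ← hne, su2a0_mul_comm (a e)⁻¹ (c e)]
    · rw [if_neg hne, if_neg hne]
  simp_rw [h2]
  by_cases hν : ν = ν'
  · subst hν
    simp only [if_true]
    rw [Finset.prod_div_distrib]
  · rw [if_neg hν]
    obtain ⟨e, he⟩ : ∃ e, ν e ≠ ν' e := Function.ne_iff.mp hν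
    exact Finset.prod_eq_zero (Finset.mem_univ e) (if_neg he)

/-! ### The reproducing integrals `p_ν h = d_ν ∫ X_ν(·, b) h(b) db` -/

/-- `p_ν h` is continuous for integrable `h` (dominated convergence, `|X_ν| ≤ d_ν`). [folklore] -/
theorem continuous_charProj (ν : Edge k L → ℕ)
    {h : GaugeConfig k L (Matrix.specialUnitaryGroup (Fin 2) ℂ) → ℝ}
    (hh : Integrable h (sliceMeasure (Matrix.specialUnitaryGroup (Fin 2) ℂ) k L)) :
    Continuous fun a : GaugeConfig k L (Matrix.specialUnitaryGroup (Fin 2) ℂ) =>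
      (∏ e, ((ν e : ℝ) + 1)) * ∫ b, (∏ e, (U ℝ (ν e)).eval (su2a0 (b e * (a e)⁻¹))) * h b
        ∂(sliceMeasure (Matrix.specialUnitaryGroup (Fin 2) ℂ) k L) := by
  refine continuous_const.mul ?_
  refine continuous_of_dominated (bound := fun b => (∏ e, ((ν e : ℝ) + 1)) * ‖h b‖) ?_ ?_ ?_ ?_
  · exact fun a => ((continuous_prod_su2Character_right ν a).aestronglyMeasurable).mul hh.aestronglyMeasurable
  · intro a
    refine Eventually.of_forall fun b => ?_
    rw [norm_mul, Real.norm_eq_abs]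
    exact mul_le_mul_of_nonneg_right (abs_prod_su2Character_le ν _) (norm_nonneg _)
  · exact hh.norm.const_mul _
  · exact Eventually.of_forall fun b => (continuous_prod_su2Character_left ν b).mul continuous_const

/-- The integrand of `p_ν h` is integrable for integrable `h`. [folklore] -/
theorem integrable_prod_su2Character_mul (ν : Edge k L → ℕ)
    {h : GaugeConfig k L (Matrix.specialUnitaryGroup (Fin 2) ℂ) → ℝ}
    (hh : Integrable h (sliceMeasure (Matrix.specialUnitaryGroup (Fin 2) ℂ) k L))
    (a : GaugeConfig k L (Matrix.specialUnitaryGroup (Fin 2) ℂ)) :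
    Integrable (fun b => (∏ e, (U ℝ (ν e)).eval (su2a0 (b e * (a e)⁻¹))) * h b)
      (sliceMeasure (Matrix.specialUnitaryGroup (Fin 2) ℂ) k L) :=
  hh.bdd_mul (continuous_prod_su2Character_right ν a).aestronglyMeasurable
    (Eventually.of_forall fun b => by rw [Real.norm_eq_abs]; exact abs_prod_su2Character_le ν _)

/-- `|p_ν h (a)| ≤ d_ν² ∫ |h|`. [folklore] -/
theorem abs_charProj_le (ν : Edge k L → ℕ)
    {h : GaugeConfig k L (Matrix.specialUnitaryGroup (Fin 2) ℂ) → ℝ}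
    (hh : Integrable h (sliceMeasure (Matrix.specialUnitaryGroup (Fin 2) ℂ) k L))
    (a : GaugeConfig k L (Matrix.specialUnitaryGroup (Fin 2) ℂ)) :
    |(∏ e, ((ν e : ℝ) + 1)) * ∫ b, (∏ e, (U ℝ (ν e)).eval (su2a0 (b e * (a e)⁻¹))) * h b
        ∂(sliceMeasure (Matrix.specialUnitaryGroup (Fin 2) ℂ) k L)| ≤
      (∏ e, ((ν e : ℝ) + 1)) ^ 2 * ∫ b, |h b| ∂(sliceMeasure (Matrix.specialUnitaryGroup (Fin 2) ℂ) k L) := by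
  have hd := prod_succ_pos (k := k) (L := L) ν
  rw [abs_mul, abs_of_pos hd, sq, mul_assoc]
  refine mul_le_mul_of_nonneg_left ?_ hd.le
  calc |∫ b, (∏ e, (U ℝ (ν e)).eval (su2a0 (b e * (a e)⁻¹))) * h b
          ∂(sliceMeasure (Matrix.specialUnitaryGroup (Fin 2) ℂ) k L)|
        = ‖∫ b, (∏ e, (U ℝ (ν e)).eval (su2a0 (b e * (a e)⁻¹))) * h b
          ∂(sliceMeasure (Matrix.specialUnitaryGroup (Fin 2) ℂ) k L)‖ := (Real.norm_eq_abs _).symm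
    _ ≤ ∫ b, (∏ e, ((ν e : ℝ) + 1)) * |h b| ∂(sliceMeasure (Matrix.specialUnitaryGroup (Fin 2) ℂ) k L) := by
          refine norm_integral_le_of_norm_le (hh.abs.const_mul _) (Eventually.of_forall fun b => ?_)
          rw [norm_mul, Real.norm_eq_abs, Real.norm_eq_abs]
          exact mul_le_mul_of_nonneg_right (abs_prod_su2Character_le ν _) (abs_nonneg _)
    _ = (∏ e, ((ν e : ℝ) + 1)) * ∫ b, |h b| ∂(sliceMeasure (Matrix.specialUnitaryGroup (Fin 2) ℂ) k L) :=
          integral_const_mul _ _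

/-- On the (compact) slice a continuous function is square integrable. [folklore] -/
theorem memLp_two_of_continuous {f : GaugeConfig k L (Matrix.specialUnitaryGroup (Fin 2) ℂ) → ℝ}
    (hf : Continuous f) : MemLp f 2 (sliceMeasure (Matrix.specialUnitaryGroup (Fin 2) ℂ) k L) := by
  obtain ⟨C, hC⟩ := isCompact_univ.exists_bound_of_continuousOn hf.continuousOn
  exact MemLp.of_bound hf.aestronglyMeasurable C (Eventually.of_forall fun b => hC b (Set.mem_univ _))

/-- **Cauchy–Schwarz on the slice**: `|∫ f g| ≤ (∫ f²)^{1/2} (∫ g²)^{1/2}` for square-integrable real `f, g`.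
[folklore] -/
theorem abs_integral_mul_le_sqrt_mul_sqrt {X : Type*} [MeasurableSpace X] {μ : Measure X} {f g : X → ℝ}
    (hf : MemLp f 2 μ) (hg : MemLp g 2 μ) :
    |∫ x, f x * g x ∂μ| ≤ Real.sqrt (∫ x, f x ^ 2 ∂μ) * Real.sqrt (∫ x, g x ^ 2 ∂μ) := by
  have h := integral_mul_norm_le_Lp_mul_Lq (μ := μ) (f := fun x => ‖f x‖) (g := fun x => ‖g x‖)
    Real.HolderConjugate.two_two (by simpa using hf.norm) (by simpa using hg.norm)
  simp only [Real.norm_eq_abs, abs_abs, Real.rpow_two, sq_abs] at h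
  rw [Real.sqrt_eq_rpow, Real.sqrt_eq_rpow]
  refine le_trans ?_ h
  refine abs_integral_le_integral_abs.trans (le_of_eq (integral_congr_ae (Eventually.of_forall fun x => ?_)))
  exact abs_mul _ _

end MultiCharacter

end Summit.Ventures.YMGap.FlowData
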